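import Mathlib
import HarnessLib

/-!
# Rung S-2 `PersistenceSurface` (stmt-ResolutionOfSingularities-19970) — POINTED CYCLES VI: NP AT EVERY CURVE OF EVERY
# `b_v ≥ max(2, val_v)` TREE (memo K-PCC §12 Thm 12.1, res-L1-w44b-lead-1 g4; kernel by res-L1-w44b-stub-1 g6, K6)

Route `ResolutionOfSingularities/HomologicalConductor`, chain W4.4b, rung S-2 `PersistenceSurface` (stmt-19970), stub C3′ /
C2 ((VAL) on the reduced-`Z_f` rational class 𝓡₁ via K-PCC Cor 12.2).  `[OURS · L1 w44b]`; replaces the role of no printed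
item; NOT a statement of the manuscript under review (Hironaka 2017); AI-written elementary lattice arithmetic, weaker than
expert review.  Def-free; independent sequel of `…PersistencePointedCycles` (p564614) / `…Definite` / `…Parity` / `…Path` /
`…Fundamental` (lead-1 g4), in the same vocabulary: an abstract integer matrix `M : ι → ι → ℤ` (`M i j = C_i·C_j`),
cycles `A : ι → ℕ`, the pairing `A·C_i = ∑ j, (A j : ℤ) * M j i`, and «`A` almost nef at `t`» = `A·C_i ≥ −δ_it`.

## The theorem (memo K-PCC v7 §12, Thm 12.1)

For a finite TREE of exceptional curves with `b_v ≥ max(2, val_v)` at every vertex (every minimal resolution graph of a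
rational surface singularity with reduced fundamental cycle, every Hirzebruch–Jung chain, every `A_ℓ`-path):
**`𝒜_t = {0}` for every `t`** — the only effective cycle `A` with `A·C_i ≥ −δ_it` for all `i` is `A = 0` (NP holds at
every curve), whence K-PCC Cor 12.2: every step of the `ca`-tower inside 𝓡₁ is KEPT.

## The kernel form and its proof (a MAXIMUM PRINCIPLE; the memo inducts on tight sub-trees instead)

Hypotheses on `M`: `0 ≤ M i j ≤ 1` off the diagonal (transversal simple intersections), `M i i ≤ −2` (`b_v ≥ 2`),
`∑ j, M j i ≤ 0` (`b_v ≥ val_v`: the reduced cycle `E` is anti-nef).  TREE-NESS enters only through an abstract ROOTED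
ORIENTATION towards `t`: a height `d : ι → ℕ` such that every neighbour of `t` is higher than `t`, and every `v ≠ t` has
one «parent» exception `p` with all OTHER neighbours of `v` higher than `v` (on a tree: `d = dist(·, t)`, `p` = the
neighbour on the path to `t`; for a path or a chain it is written down by hand).  Proof
(`eq_zero_of_isPointedAlmostNef_of_rooted`): let `0 ≠ A ∈ 𝒜_t`, `a = max A ≥ 1`, and pick `v` with `A_v = a` of
maximal height.  Always `A·C_v ≤ a·(E·C_v) ≤ 0` (`pairing_le_mul_rowsum`).  If `v ≠ t` then `A·C_v ≥ 0` forces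
`E·C_v = 0` (`v` tight) and `A_w = a` at every neighbour `w` of `v` (`apply_eq_of_pairing_eq`); a tight vertex has
`∑_{w ≠ v} M w v = −M v v ≥ 2` hence, the edges being simple, a neighbour other than its parent
(`exists_neighbour_ne`), which is higher than `v` and again maximal — contradiction.  If `v = t` then every neighbour
of `t` is higher, hence NOT maximal: `A_w ≤ a − 1` there, and `A·C_t ≤ a·M t t + (a−1)·(E·C_t − M t t) ≤ M t t ≤ −2 < −1`
(`pairing_root_le`) — contradiction with `A·C_t ≥ −1`. ∎  (Cycles in the graph are genuinely excluded: on a cycle of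
(−2)-curves with one (−3)-curve `t`, `A = E` is almost nef at `t`.)

* `pairing_le_mul_rowsum`, `apply_eq_of_pairing_eq`, `exists_neighbour_ne`, `pairing_root_le` — the four steps;
* **`eq_zero_of_isPointedAlmostNef_of_rooted`** — Thm 12.1 in rooted form; `forall_eq_zero_of_isPointedAlmostNef_of_rooted`
  (pointwise form) and **`greatest_eq_zero_of_rooted`** (the NP(t) shape used by `…PersistencePointedCycles`: the greatest
  element of `𝒜_t` is `0`).

References (mechanism only): M. Artin, Amer. J. Math. 88 (1966); J. Lipman, Publ. IHÉS 36 (1969) §18 [`Lipman1969`];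
this work (memo K-PCC v7 §12, res-L1-w44b-lead-1).
-/

-- single-problem summit: the doubled namespace component `ResolutionOfSingularities` is forced
set_option linter.dupNamespace false

namespace Summit.ResolutionOfSingularities.ResolutionOfSingularities.Theorems.HomologicalConductor.PersistencePointedCyclesTree

open Finset

variable {ι : Type*} [Fintype ι] [DecidableEq ι]

/-! ## The four steps -/

omit [DecidableEq ι] in
/-- **Step 1.** If `A ≤ a` everywhere, `A_v = a` and `M` has non-negative off-diagonal entries, then
`A·C_v ≤ a·(E·C_v)` (`E` the reduced cycle): termwise `A_j M j v ≤ a M j v`. [this work] -/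
theorem pairing_le_mul_rowsum (M : ι → ι → ℤ) (hoff : ∀ i j, i ≠ j → 0 ≤ M i j) (A : ι → ℕ) (a : ℕ)
    (ha : ∀ j, A j ≤ a) (v : ι) (hv : A v = a) :
    ∑ j, (A j : ℤ) * M j v ≤ (a : ℤ) * ∑ j, M j v := by
  rw [mul_sum]
  refine sum_le_sum fun j _ => ?_
  by_cases hj : j = v
  · subst hj; rw [hv]
  · exact mul_le_mul_of_nonneg_right (by exact_mod_cast ha j) (hoff j v hj)

omit [DecidableEq ι] in
/-- **Step 2 (tightness propagates the maximum).** If moreover `A·C_v = a·(E·C_v)`, then `A_w = a` at every neighbour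
`w` of `v` (`M w v ≠ 0`): the non-negative terms `(a − A_j) M j v` sum to zero. [this work] -/
theorem apply_eq_of_pairing_eq (M : ι → ι → ℤ) (hoff : ∀ i j, i ≠ j → 0 ≤ M i j) (A : ι → ℕ) (a : ℕ)
    (ha : ∀ j, A j ≤ a) (v : ι) (hv : A v = a) (heq : ∑ j, (A j : ℤ) * M j v = (a : ℤ) * ∑ j, M j v) :
    ∀ w, w ≠ v → M w v ≠ 0 → A w = a := by
  have hsum : ∑ j, ((a : ℤ) - A j) * M j v = 0 := by
    simp only [sub_mul]
    rw [sum_sub_distrib, ← mul_sum, heq, sub_self]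
  have hnonneg : ∀ j ∈ (univ : Finset ι), 0 ≤ ((a : ℤ) - A j) * M j v := by
    intro j _
    by_cases hj : j = v
    · subst hj; rw [hv, sub_self, zero_mul]
    · exact mul_nonneg (by have := ha j; omega) (hoff j v hj)
  intro w hw hMw
  have h0 := (sum_eq_zero_iff_of_nonneg hnonneg).mp hsum w (mem_univ w)
  rcases mul_eq_zero.mp h0 with h | h
  · have := ha w; omega
  · exact absurd h hMw

/-- **Step 3 (a tight vertex with `b ≥ 2` and simple edges has a neighbour besides its parent).** If
`∑_{j ≠ v} M j v ≥ 2` and `M j v ≤ 1` off the diagonal, then for every `p` there is a neighbour `w ≠ p` of `v`. [this work] -/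
theorem exists_neighbour_ne (M : ι → ι → ℤ) (hmult : ∀ i j, i ≠ j → M i j ≤ 1) (v : ι)
    (h2 : 2 ≤ ∑ j ∈ univ.erase v, M j v) (p : ι) : ∃ w, w ≠ v ∧ w ≠ p ∧ M w v ≠ 0 := by
  by_contra hno
  push Not at hno
  have hle : ∑ j ∈ univ.erase v, M j v ≤ 1 := by
    by_cases hp : p ∈ univ.erase v
    · rw [sum_eq_single_of_mem p hp (fun j hj hjp => hno j (ne_of_mem_erase hj) hjp)]
      exact hmult p v (ne_of_mem_erase hp)
    · rw [sum_eq_zero (fun j hj => hno j (ne_of_mem_erase hj) (fun hjp => hp (hjp ▸ hj)))]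
      norm_num
  omega

/-- **Step 4 (the root).** If `A ≤ a` everywhere with `a ≥ 1`, `A_t = a`, `A_w ≤ a − 1` at every neighbour `w` of `t`,
`M` has non-negative off-diagonal entries and `E·C_t ≤ 0`, then `A·C_t ≤ M t t`:
`A·C_t ≤ a·M t t + (a−1)·(E·C_t − M t t) = M t t + (a−1)·(E·C_t) ≤ M t t`. [this work] -/
theorem pairing_root_le (M : ι → ι → ℤ) (hoff : ∀ i j, i ≠ j → 0 ≤ M i j) (t : ι) (hrow : ∑ j, M j t ≤ 0)
    (A : ι → ℕ) (a : ℕ) (ha1 : 1 ≤ a) (ht : A t = a) (hnb : ∀ w, w ≠ t → M w t ≠ 0 → A w + 1 ≤ a) :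
    ∑ j, (A j : ℤ) * M j t ≤ M t t := by
  have hsplit : ∑ j, (A j : ℤ) * M j t = (A t : ℤ) * M t t + ∑ j ∈ univ.erase t, (A j : ℤ) * M j t := by
    rw [← sum_erase_add univ _ (mem_univ t), add_comm]
  have hrow' : ∑ j ∈ univ.erase t, M j t = ∑ j, M j t - M t t := by
    rw [← sum_erase_add univ _ (mem_univ t)]; ring
  have hbound : ∑ j ∈ univ.erase t, (A j : ℤ) * M j t ≤ ((a : ℤ) - 1) * ∑ j ∈ univ.erase t, M j t := by
    rw [mul_sum]
    refine sum_le_sum fun j hj => ?_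
    have hjt : j ≠ t := ne_of_mem_erase hj
    by_cases hM : M j t = 0
    · rw [hM, mul_zero, mul_zero]
    · have hAj : (A j : ℤ) ≤ (a : ℤ) - 1 := by have := hnb j hjt hM; omega
      exact mul_le_mul_of_nonneg_right hAj (hoff j t hjt)
  have ha1' : (0 : ℤ) ≤ (a : ℤ) - 1 := by omega
  rw [hsplit, ht]
  calc (a : ℤ) * M t t + ∑ j ∈ univ.erase t, (A j : ℤ) * M j t
      ≤ (a : ℤ) * M t t + ((a : ℤ) - 1) * (∑ j, M j t - M t t) := by rw [← hrow']; linarith [hbound]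
    _ = M t t + ((a : ℤ) - 1) * ∑ j, M j t := by ring
    _ ≤ M t t := by nlinarith [mul_nonpos_iff.mpr (Or.inl ⟨ha1', hrow⟩)]

/-! ## Thm 12.1 in rooted form -/

/-- **NP AT EVERY CURVE OF EVERY `b ≥ max(2, val)` TREE** (memo K-PCC v7 §12, Thm 12.1), rooted form.  `M` with
`0 ≤ M i j ≤ 1` off the diagonal, `M i i ≤ −2`, `∑ j, M j i ≤ 0` (`b_v ≥ val_v`); a height `d : ι → ℕ` orienting the
configuration towards `t` (every neighbour of `t` is higher than `t`; every `v ≠ t` has a parent exception `p`, all other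
neighbours of `v` being higher than `v` — e.g. `d = dist(·, t)` on a tree).  Then every effective cycle `A` with
`A·C_i ≥ −δ_it` for all `i` is ZERO: `𝒜_t = {0}`.  (Maximum principle, see the module docstring.) [this work] -/
theorem eq_zero_of_isPointedAlmostNef_of_rooted (M : ι → ι → ℤ) (hoff : ∀ i j, i ≠ j → 0 ≤ M i j)
    (hmult : ∀ i j, i ≠ j → M i j ≤ 1) (hdiag : ∀ i, M i i ≤ -2) (hrow : ∀ i, ∑ j, M j i ≤ 0) (t : ι) (d : ι → ℕ)
    (hroot : ∀ w, w ≠ t → M w t ≠ 0 → d t < d w)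
    (horient : ∀ v, v ≠ t → ∃ p, ∀ w, w ≠ v → w ≠ p → M w v ≠ 0 → d v < d w)
    (A : ι → ℕ) (hA : ∀ i, -(if i = t then (1 : ℤ) else 0) ≤ ∑ j, (A j : ℤ) * M j i) : A = 0 := by
  by_contra hA0
  -- the maximum `a ≥ 1` of `A` and a maximal vertex `v` of greatest height
  obtain ⟨i₀, hi₀⟩ : ∃ i, A i ≠ 0 := by
    by_contra h
    push Not at h
    exact hA0 (funext h)
  set a := univ.sup A with ha_def
  have ha : ∀ j, A j ≤ a := fun j => le_sup (f := A) (mem_univ j)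
  have ha1 : 1 ≤ a := le_trans (Nat.one_le_iff_ne_zero.mpr hi₀) (ha i₀)
  have hSne : (univ.filter fun v => A v = a).Nonempty := by
    obtain ⟨v, -, hv⟩ := exists_mem_eq_sup univ ⟨i₀, mem_univ i₀⟩ A
    exact ⟨v, mem_filter.mpr ⟨mem_univ v, hv.symm⟩⟩
  obtain ⟨v, hvS, hvmax⟩ := exists_max_image (univ.filter fun v => A v = a) d hSne
  have hv : A v = a := (mem_filter.mp hvS).2
  have h1 := pairing_le_mul_rowsum M hoff A a ha v hv
  by_cases hvt : v = t
  · -- `v = t`: the neighbours of `t` are higher, hence not maximal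
    subst hvt
    have hnb : ∀ w, w ≠ v → M w v ≠ 0 → A w + 1 ≤ a := by
      intro w hw hM
      have hlt : A w ≠ a := fun hwa =>
        absurd (hvmax w (mem_filter.mpr ⟨mem_univ w, hwa⟩)) (not_le.mpr (hroot w hw hM))
      have := ha w
      omega
    have h4 := pairing_root_le M hoff v (hrow v) A a ha1 hv hnb
    have h5 := hA v
    rw [if_pos rfl] at h5
    linarith [hdiag v]
  · -- `v ≠ t`: `v` is tight, its neighbours are maximal, and it has a child
    have h0 : (0 : ℤ) ≤ ∑ j, (A j : ℤ) * M j v := by have := hA v; rwa [if_neg hvt, neg_zero] at this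
    have hrow0 : ∑ j, M j v = 0 := by
      have ha0 : (0 : ℤ) < (a : ℤ) := by exact_mod_cast ha1
      nlinarith [hrow v, h0, h1]
    have heq : ∑ j, (A j : ℤ) * M j v = (a : ℤ) * ∑ j, M j v := by
      rw [hrow0, mul_zero]; exact le_antisymm (by rw [hrow0, mul_zero] at h1; exact h1) h0
    have htight := apply_eq_of_pairing_eq M hoff A a ha v hv heq
    have h2 : 2 ≤ ∑ j ∈ univ.erase v, M j v := by
      have hsplit : ∑ j, M j v = M v v + ∑ j ∈ univ.erase v, M j v := by
        rw [← sum_erase_add univ _ (mem_univ v), add_comm]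
      linarith [hdiag v]
    obtain ⟨p, hp⟩ := horient v hvt
    obtain ⟨w, hwv, hwp, hMw⟩ := exists_neighbour_ne M hmult v h2 p
    have hwa : A w = a := htight w hwv hMw
    have hle := hvmax w (mem_filter.mpr ⟨mem_univ w, hwa⟩)
    exact absurd (hp w hwv hwp hMw) (not_lt.mpr hle)

/-- Pointwise form of Thm 12.1: every almost-nef-at-`t` effective cycle vanishes identically. [this work] -/
theorem forall_eq_zero_of_isPointedAlmostNef_of_rooted (M : ι → ι → ℤ) (hoff : ∀ i j, i ≠ j → 0 ≤ M i j)
    (hmult : ∀ i j, i ≠ j → M i j ≤ 1) (hdiag : ∀ i, M i i ≤ -2) (hrow : ∀ i, ∑ j, M j i ≤ 0) (t : ι) (d : ι → ℕ)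
    (hroot : ∀ w, w ≠ t → M w t ≠ 0 → d t < d w)
    (horient : ∀ v, v ≠ t → ∃ p, ∀ w, w ≠ v → w ≠ p → M w v ≠ 0 → d v < d w)
    (A : ι → ℕ) (hA : ∀ i, -(if i = t then (1 : ℤ) else 0) ≤ ∑ j, (A j : ℤ) * M j i) (i : ι) : A i = 0 := by
  rw [eq_zero_of_isPointedAlmostNef_of_rooted M hoff hmult hdiag hrow t d hroot horient A hA]
  rfl

/-- **NP(t) in the shape used by `…PersistencePointedCycles`:** under the hypotheses of Thm 12.1, any GREATEST element
`A₀` of `𝒜_t` (the memo's `A⁽ᵗ⁾`) is `0` — so the pointed ceiling reads `ca³(T) ⊆ I(Z⁽ᵗ⁾)` at every curve of a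
`b ≥ max(2, val)` tree. [this work] -/
theorem greatest_eq_zero_of_rooted (M : ι → ι → ℤ) (hoff : ∀ i j, i ≠ j → 0 ≤ M i j)
    (hmult : ∀ i j, i ≠ j → M i j ≤ 1) (hdiag : ∀ i, M i i ≤ -2) (hrow : ∀ i, ∑ j, M j i ≤ 0) (t : ι) (d : ι → ℕ)
    (hroot : ∀ w, w ≠ t → M w t ≠ 0 → d t < d w)
    (horient : ∀ v, v ≠ t → ∃ p, ∀ w, w ≠ v → w ≠ p → M w v ≠ 0 → d v < d w)
    (A₀ : ι → ℕ)
    (hA₀ : IsGreatest {A : ι → ℕ | ∀ i, -(if i = t then (1 : ℤ) else 0) ≤ ∑ j, (A j : ℤ) * M j i} A₀) : A₀ = 0 :=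
  eq_zero_of_isPointedAlmostNef_of_rooted M hoff hmult hdiag hrow t d hroot horient A₀ hA₀.1

end Summit.ResolutionOfSingularities.ResolutionOfSingularities.Theorems.HomologicalConductor.PersistencePointedCyclesTree
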